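import Mathlib
import Literature.AlgebraicGeometry.Resolution.KummerNormalForm

/-!
# Sketch — first lemmas of the crux ideas for `RadicialJung.CleanModels`
(crux stmt-ResolutionOfSingularities-15917; ideator k = 2, round 1)

Nothing here is proved; the statements must elaborate.
-/

open IsLocalRing Polynomial

namespace Summit.ResolutionOfSingularities.ResolutionOfSingularities.Cruxes.CleanModels.Ideator2

/-! ## Card `henselian-clean-descends` — first lemma (R2, the direction not in tree)

REGULAR COVER POINT ⇒ REGULAR-TYPE DISJUNCT OF `CleanModels`, Zariski-locally, any residue field.
For a regular local ring `A` of characteristic `p` and `g ∈ A`, if the `p`-cyclic cover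
`A[T]/(T^p - g)` is regular at a maximal ideal, then `g` is residually a non-`p`-th power or differs
from a `p`-th power by a regular parameter — the embedding-dimension count (`d(T^p - g) = -dg`).
Combined with Kimura–Niitsuma monogenicity (a regular height-one degree-`p` radicial extension of the
regular `O_{V,v}` is `O_{V,v}[y']`, `y'^p = g'` admissible) this gives: wherever the normalised cover
`V^L` is regular, the class is clean in the crux's exact (Zariski) sense. The converse direction is
the tree's `isRegularLocalRing_localModel_of_derivation` / `isWoundOrTransversalAt_of_derivation`. -/
theorem regularType_of_isRegularLocalRing_cover
    (p : ℕ) [Fact p.Prime] (A : Type) [CommRing A] [IsRegularLocalRing A] [CharP A p] (g : A)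
    (P : Ideal (AdjoinRoot ((X : A[X]) ^ p - C g))) [P.IsMaximal]
    (h : IsRegularLocalRing (Localization.AtPrime P)) :
    (∀ c : A, g - c ^ p ∉ maximalIdeal A) ∨
      (∃ c : A, g - c ^ p ∈ maximalIdeal A ∧ g - c ^ p ∉ maximalIdeal A ^ 2) := by
  sorry

/-! ## Card `henselian-clean-descends` — alternative numerical route to R2

The Frobenius length criterion behind "regular cover point ⇒ Zariski-clean of type m ≤ 1"
(Kimura–Niitsuma monogenicity made numerical): in a regular local ring `C` of characteristic `p`
and dimension `d + 1`, an element `s ∈ 𝔪` cuts the Frobenius-truncated algebra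
`C ⧸ 𝔪^{[p]}` down to length exactly `p ^ d` iff `s` is a regular parameter (`s ∉ 𝔪²`).
Flatness of `O_{V,v}` over a REGULAR sandwich ring `O_X = O_V ∩ K^p(g)` forces the length
equality for the Kimura–Niitsuma generator `s`, hence `s ∈ 𝔪 ∖ 𝔪²`: toroidal type `m = 1`. -/
theorem length_quot_frobeniusPower_sup_span_eq_iff
    (p : ℕ) [Fact p.Prime] (C : Type) [CommRing C] [IsRegularLocalRing C] [CharP C p]
    (d : ℕ) (hd : (maximalIdeal C).spanFinrank = d + 1)
    (s : C) (hs : s ∈ maximalIdeal C) :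
    Module.length C (C ⧸ ((maximalIdeal C).map (frobenius C p) ⊔ Ideal.span {s})) =
        ((p ^ d : ℕ) : ℕ∞) ↔ s ∉ maximalIdeal C ^ 2 := by
  sorry

/-- Lower bound half (the direction actually used): an element of `𝔪²` never cuts
`C ⧸ 𝔪^{[p]}` down to length `p ^ d`. -/
theorem lt_length_quot_frobeniusPower_sup_span_of_mem_sq
    (p : ℕ) [Fact p.Prime] (C : Type) [CommRing C] [IsRegularLocalRing C] [CharP C p]
    (d : ℕ) (hd : (maximalIdeal C).spanFinrank = d + 1)
    (s : C) (hs : s ∈ maximalIdeal C ^ 2) :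
    ((p ^ d : ℕ) : ℕ∞) <
      Module.length C (C ⧸ ((maximalIdeal C).map (frobenius C p) ⊔ Ideal.span {s})) := by
  sorry

/-! ## Card `wound-tier-inseparable-uniformizers` — first lemma

The one-variable core of the WOUND EXIT: over a field `κ` of characteristic `p`, for the
"wound unit" `u = a + b·y^p` on the exceptional line `𝔸¹_κ = Spec κ[y]` and any `β ∈ κ`,
`u - β^p = b·(y^p - γ)` with `γ = (β^p - a)/b`; if `γ ∉ κ^p` the closed point `y^p = γ` is
INSEPARABLE over `κ` and `u - β^p` is a GENERATOR of its maximal ideal (an associate of the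
irreducible `y^p - γ`), so it is not in the square: the regular-type exit (ii) of `CleanModels`
holds at every such point. (`Irreducible (X^p - C γ)` is Mathlib's
`X_pow_sub_C_irreducible_of_prime`.) -/
theorem woundUnit_sub_pow_not_mem_sq
    (κ : Type) [Field κ] (p : ℕ) [hp : Fact p.Prime] [CharP κ p]
    (a b β : κ) (hb : b ≠ 0) (hγ : ∀ e : κ, e ^ p ≠ (β ^ p - a) / b) :
    Irreducible (X ^ p - C ((β ^ p - a) / b) : κ[X]) ∧
      (C a + C b * X ^ p - C (β ^ p) : κ[X]) ∉
        (Ideal.span {(X ^ p - C ((β ^ p - a) / b) : κ[X])}) ^ 2 := by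
  sorry

/-- Companion (separable points are wound-type (i)): if `a` is not a `p`-th power in `κ` and
`κ'/κ` is a separable algebraic extension, then `a` is still not a `p`-th power in `κ'`.
(p-independence is preserved under separable extensions; the case `r = 1`.) -/
theorem not_isPow_of_separable
    (κ κ' : Type) [Field κ] [Field κ'] [Algebra κ κ'] (p : ℕ) [Fact p.Prime] [CharP κ p]
    [Algebra.IsSeparable κ κ'] (a : κ) (ha : ∀ e : κ, e ^ p ≠ a) :
    ∀ e : κ', e ^ p ≠ algebraMap κ κ' a := by
  sorry

/-! ## Card `global-cossart-content-ideal` — first lemma (terminal-form dictionary, `r = 0`)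

With NO boundary equations, the tree's `GiraudNormalFormAt` (Giraud 1983 Prop. 1.5 rendered
derivation-free) is exactly the regular-type disjunct of `CleanModels` after the admissible shift
`a ↦ a − g^p` (the Kummer/toric exit needs a boundary index `j : Fin 0`, so it is empty). The general
`r` gives the toroidal case with the frame declared as boundary. -/
theorem giraudNormalFormAt_fin0_iff (p : ℕ) (O : Type) [CommRing O] [IsLocalRing O] (a : O) :
    Literature.AlgebraicGeometry.Resolution.GiraudNormalFormAt p (Fin.elim0 : Fin 0 → O) a ↔
      ∃ g u : O, a = g ^ p + u ∧
        ((∀ c : O, u - c ^ p ∉ maximalIdeal O) ∨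
         (∃ c : O, u - c ^ p ∈ maximalIdeal O ∧ u - c ^ p ∉ maximalIdeal O ^ 2)) := by
  sorry

end Summit.ResolutionOfSingularities.ResolutionOfSingularities.Cruxes.CleanModels.Ideator2
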